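import Literature.NumberTheory.Automorphic.ArchInnerFormCartanAtlas    -- ★ LH3-p03 (g2): `boostEig` (the eigenvalue triple `(e^{x+iθ}, e^{iφ}, e^{−x+iθ})` of a split-chart place)
import Mathlib.Analysis.SpecialFunctions.Complex.Circle
import Mathlib.Topology.Maps.Proper.Basic
import HarnessLib

/-!
# The per-place CLASS RANGES of the `G′`-charts are closed: the symmetric functions of `boostEig` (split-chart place, PROPER in `x`) and of a unit triple (compact place,
# image of a torus) — the `G′`-twin of ★ `ArchBouazizClassMapClosedRange` §1 (Bouaziz 1994 §2.3, §5.1; Rogawski 1990 §3.6, §8.2)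

Topic `NumberTheory/Rogawski1990`; namespace `Literature.NumberTheory.Rogawski1990`.  THEOREMS ONLY (no `def`, no instance, no notation, no axiom, no named fact, no `sorry`).
Cell `pub/hodgecm-mathlib`, crux H413 (`stmt-HodgeConjecture-24833`), line LH2 (closer stub `stub_N8`, organ (Sh)′), N8-INNER road (dealer LH2-plan (g1)), brick **(7) «(Σ-REG-G)»**
(owner LH3-p04 (g7), CENSUS-SigmaRegG v1.1 §5 (c)), the DEFINITION-FREE analytic core of file F2 `…ClassMapClosedRangeG` ((img): `IsClosed (range (bzClassMapG S′))`): the two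
per-place statements, written on the explicit coordinate maps so that F2 is the product-over-places bookkeeping over the chart-level class map (whatever its final letter).
Author F0P3a-p04 (g27).  Count-neutral.

THE MATHEMATICS.  The class datum of a chart point at a place `w` is the triple of elementary symmetric functions `E(λ) = (λ₀+λ₁+λ₂, λ₀λ₁+λ₀λ₂+λ₁λ₂, λ₀λ₁λ₂)` of its eigenvalue
triple (★ `bzClassG_gprimeTorus_of_mem ∕ _of_not_mem`).
* §1 SPLIT-CHART PLACE, `λ = boostEig t = (e^{x+iθ}, e^{iφ}, e^{−x+iθ})` (`x = t₀`, `φ = t₁`, `θ = t₂`): `E(boostEig t) = Φ(x, e^{iθ}, e^{iφ})` with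
  `Φ(x, u, v) = ((eˣ+e⁻ˣ)u + v, u² + (eˣ+e⁻ˣ)uv, u²v)` on `ℝ × 𝕊¹ × 𝕊¹` (`esymm_boostEig_eq`); `Φ` is PROPER — `‖Φ₁‖ ≥ eˣ + e⁻ˣ − 1`, so the preimage of a compact set lies in
  `[−R, R] × 𝕊¹ × 𝕊¹` (`isCompact_preimage_splitClassModel`) — hence has CLOSED RANGE (Mathlib `isProperMap_iff_isCompact_preimage`, `IsProperMap.isClosedMap`), and the two ranges
  agree because `t ↦ (t₀, e^{it₂}, e^{it₁})` is onto (`Circle.exp_surjective`): **`isClosed_range_esymm_boostEig`**.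
* §2 COMPACT PLACE, `λ_i = e^{it_i}`: `E` factors through the compact torus `Fin 3 → 𝕊¹`, so the range is COMPACT: **`isCompact_range_esymm_circle`**, `isClosed_range_esymm_circle`.
HONEST LABEL: topology bookkeeping; (Sh)′ ∕ row `stub_N8` stay PRINT-labelled until the N8-INNER junction is ★; HC_CM is proved only modulo the 7 printed citations (2 remaining:
hLiu418 = `stmt-HodgeConjecture-24832`, h413 = `stmt-HodgeConjecture-24833`) until rung 0 closes; this file moves no row of the books.

## References
* [Bouaziz1994IntegralesOrbitales] A. Bouaziz, *Intégrales orbitales sur les groupes de Lie réductifs*, Ann. Sci. ÉNS (4) 27 (1994) 573–609, §2.3 Lemme 2.3.1, §5.1 p. 588.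
* [Rogawski1990] J. D. Rogawski, *Automorphic Representations of Unitary Groups in Three Variables*, Ann. of Math. Stud. 123 (1990), §3.6 p. 28; §8.2 p. 122.
* [Knapp1986] A. W. Knapp, *Representation Theory of Semisimple Groups* (1986), Ch. V §3.
-/

set_option autoImplicit false

noncomputable section

open Complex Set Function Topology Filter
open Literature.NumberTheory.Automorphic.UnitaryGroup

namespace Literature.NumberTheory.Rogawski1990

/-! ## §1 Split-chart place: the symmetric functions of `boostEig` have closed range -/

section Split

/-- The split-place class model `Φ(x, u, v) = ((eˣ+e⁻ˣ)u + v, u² + (eˣ+e⁻ˣ)uv, u²v)` is continuous. [cite: Rogawski1990, §3.6 p. 28] -/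
private theorem continuous_splitClassModel :
    Continuous fun z : ℝ × Circle × Circle =>
      ((((Real.exp z.1 + Real.exp (-z.1) : ℝ) : ℂ)) * (z.2.1 : ℂ) + (z.2.2 : ℂ),
        (z.2.1 : ℂ) ^ 2 + (((Real.exp z.1 + Real.exp (-z.1) : ℝ) : ℂ)) * (z.2.1 : ℂ) * (z.2.2 : ℂ), (z.2.1 : ℂ) ^ 2 * (z.2.2 : ℂ)) := by
  have hs : Continuous fun z : ℝ × Circle × Circle => (((Real.exp z.1 + Real.exp (-z.1) : ℝ) : ℂ)) :=
    continuous_ofReal.comp ((Real.continuous_exp.comp continuous_fst).add (Real.continuous_exp.comp continuous_fst.neg))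
  have hu : Continuous fun z : ℝ × Circle × Circle => (z.2.1 : ℂ) := continuous_subtype_val.comp (continuous_fst.comp continuous_snd)
  have hv : Continuous fun z : ℝ × Circle × Circle => (z.2.2 : ℂ) := continuous_subtype_val.comp (continuous_snd.comp continuous_snd)
  exact ((hs.mul hu).add hv).prodMk (((hu.pow 2).add ((hs.mul hu).mul hv)).prodMk ((hu.pow 2).mul hv))

/-- **PROPERNESS IN `x`**: the preimage under `Φ` of a compact set is compact — on it `eˣ + e⁻ˣ = ‖(eˣ+e⁻ˣ)u‖ ≤ ‖Φ₁‖ + ‖v‖ ≤ C + 1`, so `|x| ≤ log (C + 1)`, and the preimage is a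
closed subset of `[−R, R] × 𝕊¹ × 𝕊¹`. [cite: Bouaziz1994IntegralesOrbitales, §5.1 p. 588] [cite: Rogawski1990, §3.6 p. 28] -/
private theorem isCompact_preimage_splitClassModel {K : Set (ℂ × ℂ × ℂ)} (hK : IsCompact K) :
    IsCompact ((fun z : ℝ × Circle × Circle =>
      ((((Real.exp z.1 + Real.exp (-z.1) : ℝ) : ℂ)) * (z.2.1 : ℂ) + (z.2.2 : ℂ),
        (z.2.1 : ℂ) ^ 2 + (((Real.exp z.1 + Real.exp (-z.1) : ℝ) : ℂ)) * (z.2.1 : ℂ) * (z.2.2 : ℂ), (z.2.1 : ℂ) ^ 2 * (z.2.2 : ℂ))) ⁻¹' K) := by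
  obtain ⟨C, hC⟩ := hK.isBounded.exists_norm_le
  -- a bound for `|x|` on the preimage
  have hR : ∀ z : ℝ × Circle × Circle,
      ((((Real.exp z.1 + Real.exp (-z.1) : ℝ) : ℂ)) * (z.2.1 : ℂ) + (z.2.2 : ℂ),
        (z.2.1 : ℂ) ^ 2 + (((Real.exp z.1 + Real.exp (-z.1) : ℝ) : ℂ)) * (z.2.1 : ℂ) * (z.2.2 : ℂ), (z.2.1 : ℂ) ^ 2 * (z.2.2 : ℂ)) ∈ K →
        z.1 ∈ Icc (-Real.log (|C| + 1)) (Real.log (|C| + 1)) := by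
    intro z hz
    have h1 : ‖(((Real.exp z.1 + Real.exp (-z.1) : ℝ) : ℂ)) * (z.2.1 : ℂ) + (z.2.2 : ℂ)‖ ≤ |C| :=
      ((norm_fst_le _).trans (hC _ hz)).trans (le_abs_self C)
    have hpos : 0 ≤ Real.exp z.1 + Real.exp (-z.1) := by positivity
    have hs : Real.exp z.1 + Real.exp (-z.1) ≤ |C| + 1 := by
      have hnorm : ‖(((Real.exp z.1 + Real.exp (-z.1) : ℝ) : ℂ)) * (z.2.1 : ℂ)‖ = Real.exp z.1 + Real.exp (-z.1) := by
        rw [norm_mul, Complex.norm_of_nonneg hpos, Circle.norm_coe, mul_one]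
      have htri : ‖(((Real.exp z.1 + Real.exp (-z.1) : ℝ) : ℂ)) * (z.2.1 : ℂ)‖ ≤
          ‖(((Real.exp z.1 + Real.exp (-z.1) : ℝ) : ℂ)) * (z.2.1 : ℂ) + (z.2.2 : ℂ)‖ + ‖(z.2.2 : ℂ)‖ := by
        have h := norm_add_le ((((Real.exp z.1 + Real.exp (-z.1) : ℝ) : ℂ)) * (z.2.1 : ℂ) + (z.2.2 : ℂ)) (-(z.2.2 : ℂ))
        rwa [add_neg_cancel_right, norm_neg] at h
      rw [hnorm, Circle.norm_coe] at htri
      linarith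
    have hC1 : 0 < |C| + 1 := by positivity
    constructor
    · have h : Real.exp (-z.1) ≤ |C| + 1 := by linarith [Real.exp_pos z.1]
      have := (Real.le_log_iff_exp_le hC1).2 h
      linarith
    · have h : Real.exp z.1 ≤ |C| + 1 := by linarith [Real.exp_pos (-z.1)]
      exact (Real.le_log_iff_exp_le hC1).2 h
  refine ((isCompact_Icc (a := -Real.log (|C| + 1)) (b := Real.log (|C| + 1))).prod isCompact_univ).of_isClosed_subset
    (hK.isClosed.preimage continuous_splitClassModel) fun z hz => ⟨hR z hz, Set.mem_univ _⟩

/-- **The split-place class model has CLOSED RANGE** (a proper map into a locally compact Hausdorff space is closed). [cite: Bouaziz1994IntegralesOrbitales, §2.3 Lemme 2.3.1; §5.1 p. 588] -/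
private theorem isClosed_range_splitClassModel :
    IsClosed (Set.range fun z : ℝ × Circle × Circle =>
      ((((Real.exp z.1 + Real.exp (-z.1) : ℝ) : ℂ)) * (z.2.1 : ℂ) + (z.2.2 : ℂ),
        (z.2.1 : ℂ) ^ 2 + (((Real.exp z.1 + Real.exp (-z.1) : ℝ) : ℂ)) * (z.2.1 : ℂ) * (z.2.2 : ℂ), (z.2.1 : ℂ) ^ 2 * (z.2.2 : ℂ))) :=
  (isProperMap_iff_isCompact_preimage.2 ⟨continuous_splitClassModel, fun _ hK => isCompact_preimage_splitClassModel hK⟩).isClosedMap.isClosed_range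

/-- **The symmetric functions of `boostEig t` are the split-place class model at `(t₀, e^{it₂}, e^{it₁})`**:
`e^{x+iθ} + e^{iφ} + e^{−x+iθ} = (eˣ+e⁻ˣ)e^{iθ} + e^{iφ}`, `Σλλ′ = e^{2iθ} + (eˣ+e⁻ˣ)e^{iθ}e^{iφ}`, `λλ′λ″ = e^{2iθ}e^{iφ}`. [cite: Rogawski1990, §3.6 p. 28] [cite: Knapp1986, Ch. V §3] -/
theorem esymm_boostEig_eq (t : Fin 3 → ℝ) :
    (boostEig t 0 + boostEig t 1 + boostEig t 2, boostEig t 0 * boostEig t 1 + boostEig t 0 * boostEig t 2 + boostEig t 1 * boostEig t 2, boostEig t 0 * boostEig t 1 * boostEig t 2) =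
      ((((Real.exp (t 0) + Real.exp (-(t 0)) : ℝ) : ℂ)) * (Circle.exp (t 2) : ℂ) + (Circle.exp (t 1) : ℂ),
        (Circle.exp (t 2) : ℂ) ^ 2 + (((Real.exp (t 0) + Real.exp (-(t 0)) : ℝ) : ℂ)) * (Circle.exp (t 2) : ℂ) * (Circle.exp (t 1) : ℂ),
        (Circle.exp (t 2) : ℂ) ^ 2 * (Circle.exp (t 1) : ℂ)) := by
  have h0 : boostEig t 0 = Complex.exp (t 0 : ℂ) * Complex.exp ((t 2 : ℂ) * I) := by
    show Complex.exp ((t 0 : ℂ) + (t 2 : ℂ) * I) = _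
    rw [Complex.exp_add]
  have h1 : boostEig t 1 = Complex.exp ((t 1 : ℂ) * I) := rfl
  have h2 : boostEig t 2 = (Complex.exp (t 0 : ℂ))⁻¹ * Complex.exp ((t 2 : ℂ) * I) := by
    show Complex.exp (-(t 0 : ℂ) + (t 2 : ℂ) * I) = _
    rw [Complex.exp_add, Complex.exp_neg]
  have hs : (((Real.exp (t 0) + Real.exp (-(t 0)) : ℝ) : ℂ)) = Complex.exp (t 0 : ℂ) + (Complex.exp (t 0 : ℂ))⁻¹ := by
    rw [Complex.ofReal_add, Real.exp_neg, Complex.ofReal_inv, Complex.ofReal_exp]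
  have ha : Complex.exp (t 0 : ℂ) ≠ 0 := Complex.exp_ne_zero _
  rw [h0, h1, h2, hs, Circle.coe_exp, Circle.coe_exp]
  simp only [Prod.mk.injEq]
  refine ⟨by ring, ?_, ?_⟩
  · field_simp
    ring
  · field_simp

/-- **(img)-SPLIT: THE SYMMETRIC FUNCTIONS OF `boostEig` HAVE CLOSED RANGE** on `Fin 3 → ℝ` — the range equals that of the proper split-place class model, `t ↦ (t₀, e^{it₂}, e^{it₁})`
being onto `ℝ × 𝕊¹ × 𝕊¹` (`Circle.exp_surjective`). [cite: Bouaziz1994IntegralesOrbitales, §2.3 Lemme 2.3.1; §5.1 p. 588] [cite: Rogawski1990, §3.6 p. 28] -/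
theorem isClosed_range_esymm_boostEig :
    IsClosed (Set.range fun t : Fin 3 → ℝ =>
      (boostEig t 0 + boostEig t 1 + boostEig t 2, boostEig t 0 * boostEig t 1 + boostEig t 0 * boostEig t 2 + boostEig t 1 * boostEig t 2, boostEig t 0 * boostEig t 1 * boostEig t 2)) := by
  have hfun : (fun t : Fin 3 → ℝ =>
      (boostEig t 0 + boostEig t 1 + boostEig t 2, boostEig t 0 * boostEig t 1 + boostEig t 0 * boostEig t 2 + boostEig t 1 * boostEig t 2, boostEig t 0 * boostEig t 1 * boostEig t 2)) =
      (fun z : ℝ × Circle × Circle =>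
        ((((Real.exp z.1 + Real.exp (-z.1) : ℝ) : ℂ)) * (z.2.1 : ℂ) + (z.2.2 : ℂ),
          (z.2.1 : ℂ) ^ 2 + (((Real.exp z.1 + Real.exp (-z.1) : ℝ) : ℂ)) * (z.2.1 : ℂ) * (z.2.2 : ℂ), (z.2.1 : ℂ) ^ 2 * (z.2.2 : ℂ))) ∘
        fun t : Fin 3 → ℝ => (t 0, Circle.exp (t 2), Circle.exp (t 1)) := by
    funext t; exact esymm_boostEig_eq t
  have hsurj : Surjective fun t : Fin 3 → ℝ => ((t 0, Circle.exp (t 2), Circle.exp (t 1)) : ℝ × Circle × Circle) := by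
    rintro ⟨x, u, v⟩
    obtain ⟨θ, hθ⟩ := Circle.exp_surjective u
    obtain ⟨φ, hφ⟩ := Circle.exp_surjective v
    exact ⟨![x, φ, θ], by simp [hθ, hφ]⟩
  rw [hfun, Set.range_comp, hsurj.range_eq, Set.image_univ]
  exact isClosed_range_splitClassModel

end Split

/-! ## §2 Compact place: the symmetric functions of a unit triple have compact range -/

section Compact

/-- **(img)-COMPACT: THE SYMMETRIC FUNCTIONS OF `(e^{it₀}, e^{it₁}, e^{it₂})` HAVE COMPACT RANGE** — the map factors through the compact torus `Fin 3 → 𝕊¹` (`Circle.exp` onto).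
[cite: Rogawski1990, §8.2 p. 122] [cite: Bouaziz1994IntegralesOrbitales, §5.1 p. 588] -/
theorem isCompact_range_esymm_circle :
    IsCompact (Set.range fun t : Fin 3 → ℝ =>
      (Complex.exp ((t 0 : ℂ) * I) + Complex.exp ((t 1 : ℂ) * I) + Complex.exp ((t 2 : ℂ) * I),
        Complex.exp ((t 0 : ℂ) * I) * Complex.exp ((t 1 : ℂ) * I) + Complex.exp ((t 0 : ℂ) * I) * Complex.exp ((t 2 : ℂ) * I) + Complex.exp ((t 1 : ℂ) * I) * Complex.exp ((t 2 : ℂ) * I),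
        Complex.exp ((t 0 : ℂ) * I) * Complex.exp ((t 1 : ℂ) * I) * Complex.exp ((t 2 : ℂ) * I))) := by
  have hfun : (fun t : Fin 3 → ℝ =>
      (Complex.exp ((t 0 : ℂ) * I) + Complex.exp ((t 1 : ℂ) * I) + Complex.exp ((t 2 : ℂ) * I),
        Complex.exp ((t 0 : ℂ) * I) * Complex.exp ((t 1 : ℂ) * I) + Complex.exp ((t 0 : ℂ) * I) * Complex.exp ((t 2 : ℂ) * I) + Complex.exp ((t 1 : ℂ) * I) * Complex.exp ((t 2 : ℂ) * I),
        Complex.exp ((t 0 : ℂ) * I) * Complex.exp ((t 1 : ℂ) * I) * Complex.exp ((t 2 : ℂ) * I))) =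
      (fun z : Fin 3 → Circle => ((z 0 : ℂ) + (z 1 : ℂ) + (z 2 : ℂ), (z 0 : ℂ) * (z 1 : ℂ) + (z 0 : ℂ) * (z 2 : ℂ) + (z 1 : ℂ) * (z 2 : ℂ), (z 0 : ℂ) * (z 1 : ℂ) * (z 2 : ℂ))) ∘
        fun t : Fin 3 → ℝ => fun i => Circle.exp (t i) := by
    funext t
    simp only [Function.comp_apply, Circle.coe_exp]
  have hsurj : Surjective fun t : Fin 3 → ℝ => fun i => Circle.exp (t i) := by
    intro z
    choose t ht using fun i => Circle.exp_surjective (z i)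
    exact ⟨t, funext ht⟩
  rw [hfun, Set.range_comp, hsurj.range_eq, Set.image_univ]
  have hc : ∀ i : Fin 3, Continuous fun z : Fin 3 → Circle => ((z i : Circle) : ℂ) := fun i => continuous_subtype_val.comp (continuous_apply i)
  exact isCompact_range ((((hc 0).add (hc 1)).add (hc 2)).prodMk (((((hc 0).mul (hc 1)).add ((hc 0).mul (hc 2))).add ((hc 1).mul (hc 2))).prodMk
    (((hc 0).mul (hc 1)).mul (hc 2))))

/-- The compact-place class range is closed. [cite: Bouaziz1994IntegralesOrbitales, §5.1 p. 588] -/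
theorem isClosed_range_esymm_circle :
    IsClosed (Set.range fun t : Fin 3 → ℝ =>
      (Complex.exp ((t 0 : ℂ) * I) + Complex.exp ((t 1 : ℂ) * I) + Complex.exp ((t 2 : ℂ) * I),
        Complex.exp ((t 0 : ℂ) * I) * Complex.exp ((t 1 : ℂ) * I) + Complex.exp ((t 0 : ℂ) * I) * Complex.exp ((t 2 : ℂ) * I) + Complex.exp ((t 1 : ℂ) * I) * Complex.exp ((t 2 : ℂ) * I),
        Complex.exp ((t 0 : ℂ) * I) * Complex.exp ((t 1 : ℂ) * I) * Complex.exp ((t 2 : ℂ) * I))) :=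
  isCompact_range_esymm_circle.isClosed

end Compact

end Literature.NumberTheory.Rogawski1990

end
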